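import Mathlib.Analysis.SpecialFunctions.Trigonometric.Angle
import Literature.MathematicalPhysics.QuantumFieldTheory.TorusChartFlatCochains
import HarnessLib

/-!
# The spin-wave lift: small-gradient angle configurations on a torus are vortex-free and lift to real fields

The spin-wave parametrisation of `XY`-type models on a charted discrete torus (`TorusChart.lean`).  For an angle
configuration `θ : Λ → Real.Angle` (`Real.Angle = ℝ/2πℤ`) the **reduced gradient field**
`redGrad θ (x, i) ∈ (-π, π]` is the principal value of `θ (x + e_i) - θ x`.  Its plaquette circulations are
integer multiples of `2π` (the vorticities), so when all reduced gradients are `< π/2` in absolute value every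
circulation vanishes (`isFlat_redGrad_of_abs_lt`: small-gradient configurations are vortex-free); its windings
are always integer multiples of `2π` (`exists_wind_redGrad_eq`); hence, by the structure theorem of
`TorusChartFlatCochains.lean`, for every VORTEX-FREE configuration (flat reduced gradient field)
**`redGrad θ = d₀ φ + seam (2π k)` for a real field `φ` with `φ ≡ θ (mod 2π)` pointwise and an integer winding
vector `k`** (`exists_lift_of_isFlat_redGrad`, explicit lift `coe_prim_redGrad_add`; small gradients:
`exists_lift_of_abs_redGrad_lt`).  In an `XY`-type Gibbs
factor every `e^{i n·θ}` may thus be rewritten in terms of `φ`, and the small-gradient ("spin-wave") part of the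
partition function becomes a sum over winding sectors of integrals over real fields.
-/

namespace Literature.MathematicalPhysics.QuantumFieldTheory

open scoped BigOperators

namespace TorusChart

variable {Λ : Type*} [AddCommGroup Λ] {d : ℕ} (F : TorusChart Λ d)

/-! ## Angle configurations: small reduced gradients are vortex-free and lift to real fields

The spin-wave parametrisation of `XY`-type models on a charted torus.  For an angle configuration
`θ : Λ → Real.Angle` (`Real.Angle = ℝ/2πℤ`), the **reduced gradient field** `redGrad θ (x, i) ∈ (-π, π]` is the
principal value of `θ (x + e_i) - θ x`.  Its plaquette circulations are integer multiples of `2π` (the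
vorticities), so if all reduced gradients of a plaquette are `< π/2` in absolute value the circulation vanishes:
small-gradient configurations are vortex-free, i.e. `redGrad θ` is a flat real cochain, hence
`redGrad θ = d₀ φ + seam (2π k)` for a real field `φ` lifting `θ` pointwise and an integer winding vector `k`.
-/

section Angle

open Real

/-- The **reduced gradient field** of an angle configuration: the principal value in `(-π, π]` of the
difference of the angles at the ends of each edge. [folklore] -/
noncomputable def redGrad (θ : Λ → Real.Angle) : Λ → Fin d → ℝ := fun x i => (F.d₀ θ x i).toReal

/-- Unfolding `redGrad`. [folklore] -/
theorem redGrad_apply (θ : Λ → Real.Angle) (x : Λ) (i : Fin d) :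
    F.redGrad θ x i = (θ (x + F.gen i) - θ x).toReal := rfl

/-- The reduced gradient reduces to the angle gradient. [folklore] -/
@[simp] theorem coe_redGrad (θ : Λ → Real.Angle) (x : Λ) (i : Fin d) :
    ((F.redGrad θ x i : ℝ) : Real.Angle) = F.d₀ θ x i :=
  Real.Angle.coe_toReal _

/-- Reduced gradients lie in `(-π, π]`: upper bound in absolute value. [folklore] -/
theorem abs_redGrad_le (θ : Λ → Real.Angle) (x : Λ) (i : Fin d) : |F.redGrad θ x i| ≤ π :=
  Real.Angle.abs_toReal_le_pi _

/-- A real number of absolute value `< 2π` which vanishes as an angle vanishes. [folklore] -/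
theorem eq_zero_of_coe_angle_eq_zero_of_abs_lt {a : ℝ} (ha : (a : Real.Angle) = 0) (hlt : |a| < 2 * π) :
    a = 0 := by
  obtain ⟨n, rfl⟩ := Real.Angle.coe_eq_zero_iff.1 ha
  have hπ : 0 < 2 * π := Real.two_pi_pos
  rw [zsmul_eq_mul, abs_mul, abs_of_pos hπ] at hlt
  have hn : |(n : ℝ)| < 1 := by
    by_contra h
    exact absurd hlt (not_lt.2 (le_mul_of_one_le_left hπ.le (not_lt.1 h)))
  have hn' : |n| < 1 := by
    have : ((|n| : ℤ) : ℝ) < 1 := by rw [Int.cast_abs]; exact hn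
    exact_mod_cast this
  have hn0 : n = 0 := Int.abs_lt_one_iff.1 hn'
  simp [hn0]

variable {F} in
/-- **Small edge values force flatness**: a real `1`-cochain whose reduction modulo `2π` is flat (e.g. the
reduced gradient field of any angle configuration) and all of whose edge values are `< π/2` in absolute value
is flat — each plaquette circulation is a multiple of `2π` of absolute value `< 2π`. [folklore] -/
theorem isFlat_of_isFlat_coe_angle_of_abs_lt {η : Λ → Fin d → ℝ}
    (hflat : F.IsFlat fun x i => (η x i : Real.Angle)) (hsmall : ∀ x i, |η x i| < π / 2) : F.IsFlat η := by
  intro x i j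
  refine eq_zero_of_coe_angle_eq_zero_of_abs_lt ?_ ?_
  · have h := F.map_d₁ Real.Angle.coeHom η x i j
    rw [Real.Angle.coe_coeHom] at h
    rw [h]
    exact hflat x i j
  · rw [d₁_apply]
    have h1 := hsmall x i; have h2 := hsmall (x + F.gen i) j
    have h3 := hsmall (x + F.gen j) i; have h4 := hsmall x j
    rw [abs_lt] at h1 h2 h3 h4 ⊢
    constructor <;> linarith [h1.1, h1.2, h2.1, h2.2, h3.1, h3.2, h4.1, h4.2]

variable {F} in
/-- **Small-gradient angle configurations are vortex-free**: if every reduced gradient of `θ` is `< π/2` in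
absolute value, the reduced gradient field is a flat real cochain. [folklore] -/
theorem isFlat_redGrad_of_abs_lt {θ : Λ → Real.Angle} (hsmall : ∀ x i, |F.redGrad θ x i| < π / 2) :
    F.IsFlat (F.redGrad θ) := by
  refine isFlat_of_isFlat_coe_angle_of_abs_lt (fun x i j => ?_) hsmall
  have h : (fun y k => ((F.redGrad θ y k : ℝ) : Real.Angle)) = F.d₀ θ := by
    funext y k; exact F.coe_redGrad θ y k
  rw [h]
  exact F.isFlat_d₀ θ x i j

/-- **Windings of the reduced gradient field are integer multiples of `2π`** (for every angle configuration,
small gradients or not): modulo `2π` the winding is that of the gradient `d₀ θ`, which vanishes. [folklore] -/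
theorem exists_wind_redGrad_eq (θ : Λ → Real.Angle) (μ : Fin d) :
    ∃ k : ℤ, F.wind (F.redGrad θ) μ = k • (2 * π) := by
  have h : ((F.wind (F.redGrad θ) μ : ℝ) : Real.Angle) = 0 := by
    have h1 := F.map_wind Real.Angle.coeHom (F.redGrad θ) μ
    rw [Real.Angle.coe_coeHom] at h1
    rw [h1]
    have h2 : (fun z k => ((F.redGrad θ z k : ℝ) : Real.Angle)) = F.d₀ θ := by
      funext y k; exact F.coe_redGrad θ y k
    rw [h2, wind_d₀, Pi.zero_apply]
  obtain ⟨k, hk⟩ := Real.Angle.coe_eq_zero_iff.1 h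
  exact ⟨k, hk.symm⟩

variable {F} in
/-- **Lifting along the axial primitive.** For an angle configuration `θ` with flat reduced gradient field
(a vortex-free configuration) and any real `c ≡ θ 0 (mod 2π)`, the real field `prim (redGrad θ) + c` reduces to
`θ` at every site. [folklore] -/
theorem coe_prim_redGrad_add {θ : Λ → Real.Angle} (hflat : F.IsFlat (F.redGrad θ)) {c : ℝ}
    (hc : (c : Real.Angle) = θ 0) (x : Λ) : ((F.prim (F.redGrad θ) x + c : ℝ) : Real.Angle) = θ x := by
  choose k hk using F.exists_wind_redGrad_eq θ
  have hwk : F.wind (F.redGrad θ) = fun μ => k μ • (2 * π) := funext hk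
  set φ : Λ → ℝ := fun y => F.prim (F.redGrad θ) y + c with hφ
  have hd₀φ : F.d₀ φ = F.d₀ (F.prim (F.redGrad θ)) := by
    funext y i; simp only [hφ, d₀_apply]; abel
  have hdec : F.redGrad θ = F.d₀ φ + F.seam fun μ => k μ • (2 * π) := by
    rw [hd₀φ, ← hwk]; exact eq_d₀_prim_add_seam_wind hflat
  -- modulo `2π`: `d₀ (φ mod 2π) = d₀ θ`, so `φ mod 2π - θ` is constant, and it vanishes at the origin
  have hcoe : F.d₀ (fun y => ((φ y : ℝ) : Real.Angle)) = F.d₀ θ := by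
    funext y i
    have hmap := F.map_d₀ Real.Angle.coeHom φ y i
    have hms := F.map_seam Real.Angle.coeHom (fun μ => k μ • (2 * π)) y i
    rw [Real.Angle.coe_coeHom] at hmap hms
    have := congr_fun (congr_fun hdec y) i
    rw [Pi.add_apply, Pi.add_apply] at this
    rw [← hmap, ← F.coe_redGrad θ y i, this, Real.Angle.coe_add, hms]
    have hs : (fun ν => ((k ν • (2 * π) : ℝ) : Real.Angle)) = 0 := by
      funext ν; rw [Real.Angle.coe_zsmul, Real.Angle.coe_two_pi, zsmul_zero, Pi.zero_apply]
    rw [hs, seam_zero, Pi.zero_apply, Pi.zero_apply, add_zero]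
  have hconst := (F.d₀_eq_zero_iff (fun y => ((φ y : ℝ) : Real.Angle) - θ y)).1 (by
    rw [show (fun y => ((φ y : ℝ) : Real.Angle) - θ y) = (fun y => ((φ y : ℝ) : Real.Angle)) - θ from rfl,
      d₀_sub, hcoe, sub_self]) x
  have h0 : ((φ 0 : ℝ) : Real.Angle) = θ 0 := by
    simp only [hφ, prim_origin, zero_add, hc]
  rw [h0, sub_self, sub_eq_zero] at hconst
  exact hconst

variable {F} in
/-- The gradient of the lift: for a vortex-free `θ`, `redGrad θ = d₀ (prim (redGrad θ) + c) + seam (wind (redGrad θ))`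
for every constant `c`. [folklore] -/
theorem redGrad_eq_d₀_prim_add_seam {θ : Λ → Real.Angle} (hflat : F.IsFlat (F.redGrad θ)) (c : ℝ) :
    F.redGrad θ = F.d₀ (fun x => F.prim (F.redGrad θ) x + c) + F.seam (F.wind (F.redGrad θ)) := by
  have hd : F.d₀ (fun x => F.prim (F.redGrad θ) x + c) = F.d₀ (F.prim (F.redGrad θ)) := by
    funext y i; simp only [d₀_apply]; abel
  rw [hd]; exact eq_d₀_prim_add_seam_wind hflat

variable {F} in
/-- **The spin-wave lift of a vortex-free configuration.** An angle configuration with flat reduced gradient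
field lifts to a real field: there are `φ : Λ → ℝ` with `φ x ≡ θ x (mod 2π)` at every site and an integer
winding vector `k` with `redGrad θ = d₀ φ + seam (2π k)` — the reduced gradients ARE the gradients of `φ`,
except across the seams where they jump by `2π k_μ`. [folklore] -/
theorem exists_lift_of_isFlat_redGrad {θ : Λ → Real.Angle} (hflat : F.IsFlat (F.redGrad θ)) :
    ∃ (φ : Λ → ℝ) (k : Fin d → ℤ), (∀ x, (φ x : Real.Angle) = θ x) ∧
      F.redGrad θ = F.d₀ φ + F.seam fun μ => k μ • (2 * π) := by
  choose k hk using F.exists_wind_redGrad_eq θ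
  have hwk : F.wind (F.redGrad θ) = fun μ => k μ • (2 * π) := funext hk
  refine ⟨fun x => F.prim (F.redGrad θ) x + (θ 0).toReal, k,
    coe_prim_redGrad_add hflat (Real.Angle.coe_toReal _), ?_⟩
  rw [← hwk]; exact redGrad_eq_d₀_prim_add_seam hflat _

variable {F} in
/-- **The spin-wave lift of a small-gradient configuration**: an angle configuration all of whose reduced
gradients are `< π/2` in absolute value lifts to a real field `φ ≡ θ (mod 2π)` with
`redGrad θ = d₀ φ + seam (2π k)` for an integer winding vector `k`. [folklore] -/
theorem exists_lift_of_abs_redGrad_lt {θ : Λ → Real.Angle} (hsmall : ∀ x i, |F.redGrad θ x i| < π / 2) :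
    ∃ (φ : Λ → ℝ) (k : Fin d → ℤ), (∀ x, (φ x : Real.Angle) = θ x) ∧
      F.redGrad θ = F.d₀ φ + F.seam fun μ => k μ • (2 * π) :=
  exists_lift_of_isFlat_redGrad (isFlat_redGrad_of_abs_lt hsmall)

end Angle
end TorusChart

end Literature.MathematicalPhysics.QuantumFieldTheory
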